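import Literature.MathematicalPhysics.QuantumFieldTheory.Balaban1983to89.B6Eq24Partition
import Mathlib
import Literature.MathematicalPhysics.QuantumFieldTheory.Balaban1983to89.B4Block227
import Literature.MathematicalPhysics.QuantumFieldTheory.Balaban1983to89.B4Block227Sharp

/-!
# `Balaban1983to89.B6Eq211` — T. Bałaban, *Propagators and renormalization transformations for lattice gauge
theories. II*, Commun. Math. Phys. **96** (1984) 223–250 [Balaban1984PropagatorsII]: the multiscale Poincaré
inequality **(2.11)** p. 225, PROVED (with the gap constant `8`) by the printed route *"[3, 2.26, and 2.27]"*

statement-level skeleton of published theorems with citation tags; proofs where landed; nothing here is a claim about the Yang–Mills mass gap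

PDF held: `paper:balaban1984-cmp96-propagators-rt-ii` (journal page = PDF page + 222); the displays below were read
from the page renders `run/shared/lean/pub/pub-balaban/b2b-balaban-ref1/pages/1984-cmp96-propagators-rt-II/…-p002-x2.png`
(p. 224), `…-p003-x2.png` (p. 225), `[3]` = [Balaban1983RegularityDecay] p. 580 (`…1983-cmp89-regularity-decay-p010-
x2.png`) and `[4]` = [Balaban1984PropagatorsI] pp. 18–21 (`…1984-cmp95-propagators-rt-I-p002…p005-x2.png`), AS IMAGES.

CITATION HEADER / WHAT IS REPRODUCED.  Cell `lit-balaban`, Phase 2 seat **p03** (unit `lit-balaban-p03`, HOME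
`run/shared/lean/pub/lit-balaban/`), SKELETON row **B6.Eq2.11** (nominated decl `B6Eq211.ineq211`; of record before
this file: the abstract block bound `B4.Display227Printed` / `B4.Display227Repaired` of [3] and the hypothesis `hinj`
of `B6SectA.orbitMinimiser_unique`).  Printed, p. 225 [PDF 3], verbatim: *"Equation (2.9) implies Δλ₀ = R∂*A, and
this equation has exactly one solution because the Laplace operator Δ is positive on the subspace N(Q′), hence it is
invertible on this subspace. More exactly we have the inequality
  ⟨λ, Δλ⟩ ≥ π² Σ_{j=1}^k (L^jη)^{−2} Σ_{x∈B^j(Λ_j)} η^d|λ(x)|²,   λ ∈ N(Q′),   (2.11)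
as it follows from [3, 2.26, and 2.27]."*; and, after (2.17): *"The operator G′ = Δ′_a^{−1} is a well defined, positive
operator because Δ′_a satisfies the inequality (2.11) for all λ, with min{a_j, π²} instead of π² and the index j
running from 0 to k on the right-hand side."*, where (2.14) `⟨λ, Q′*aQ′λ⟩ = Σ_{j=0}^k Σ_{y∈Λ_j} a_j(L^jη)^{d−2}
|(Q′_jλ)(y)|²`.  The geometry (2.1)–(2.4), the blocks `B^j(y)`, the averages `Q′_j` and `N(Q′)` (2.7)/(2.10) are the
sibling `…Balaban1983to89.B6Eq24Partition` (same seat; its module docstring quotes them); `Δ` is [4]'s positive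
η-lattice Laplace operator, `⟨λ, Δλ⟩ = ⟨∂λ, ∂λ⟩ = Σ_b η^d|η^{−1}(λ(b₊) − λ(b₋))|²` ((1.4) p. 18, (1.21) p. 21), and
[3] (2.26)–(2.27) p. 580 are: drop the bonds joining different blocks, then bound each block's Neumann form from below
on the functions orthogonal to constants.

THE CONSTANT (census G-B4-03 of the cell `pub-balaban`; `B4.Display227Printed` docstring; kernel theorem
`B4Block227Sharp.not_display227Printed_pi_sq`): the printed `π²` is [3]'s slip in (2.27) — the Neumann gap of the
lattice Laplacian on a block with `s ≥ 2` sites per side is `4s²sin²(π/2s) ∈ [8, π²[` in units of (side)⁻², never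
`π²` — and the slip propagates to (2.11): in the admitted geometry `k = 1`, `Ω₁ = T_η` a torus of `2 × 1 × … × 1`
blocks of side `L ≥ 2` (p. 224: *"we admit the case when some domains Ω_j are equal to T_η"*), the block-mean-zero
cosine mode `cos(π(x₁+½)/L)` on one block, continued by even reflection to the other, is periodic, lies in `N(Q′)`, and
has `⟨λ,Δλ⟩ = 4L²sin²(π/2L)·(Lη)^{−2}‖λ‖² < π²(Lη)^{−2}‖λ‖²` (e.g. `L = 3`, `d = 1`: `λ = (√3/2, 0, −√3/2, −√3/2, 0,
√3/2)` on `ℤ/6`, energy `3 = ‖λ‖²`, while `π²/9 > 1`).  Following the reader's nomination (PHASE2-TARGETS §F.1/§G.3: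
*"constant = B4's repaired 8 in place of π²"*) this file proves (2.11) with the valid absolute constant **`8`**; nothing
downstream in the paper uses the value `π²` (only positivity of Δ on `N(Q′)` and an `O(1)` constant).

CARRIER / DICTIONARY: as in `B6Eq24Partition` (lattice units `η = 1`; `T_η` ↦ a finite `T ⊂ ℤ^D`, `D` = the
dimension; `B^j(y) = B4TwoScaleForm.ablock (L^j) y`; `G : Domains D` carries `L, k, T, Ω` with (2.1)); here in
addition `⟨λ,Δλ⟩·η^{2−D}` ↦ the forward-bond energy `Σ_{z∈T}Σ_μ|λ(z+e_μ) − λ(z)|²`, which on a period box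
`T = B4TorusPositivity.box P` of a `P`-periodic `λ` IS `Σ_z conj λ(z)·(Δλ)(z)` with `Δ = B4Green244.negLap 1`, every
bond of the torus counted once (`inner_negLap_eq_fwd`, from `B4TorusPositivity.grad_term`), and which dominates the
Neumann energy `B4TwoScaleForm.gradS T λ` (bonds with both ends in `T`) of the sharper statements; `η` is restored in
`ineq211_eta`.  `λ` is complex-valued (print: real; the real case is included).

WHAT IS PROVED (kernel-checked, 0 sorry, no definitions, no `Prop`-valued fact; `B6Eq24Partition` + Mathlib only):
* §1 the engine *"[3, 2.26, and 2.27]"* for an arbitrary finite, pairwise disjoint family of aligned blocks of several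
  sizes inside `T`: `ablocks_form_lower_bound` (all `λ`, with averaging weights — the shape of the Δ′_a sentence;
  (2.26) = `B4TwoScaleForm.sum_gradS_le`, (2.27) repaired = `B4TwoScaleForm.cell_bound` ← `B4Block227.block227`) and
  `ablocks_meanZero_lower_bound` (`8·Σ_i N_i^{−2}Σ_{B_i}|λ|² ≤ ⟨λ,(−Δ^N_T)λ⟩` when every block sum vanishes);
* §2 **(2.11)** on `N(Q′)` over `G : Domains D`: `ineq211` (the nominated statement: forward/torus energy, `j = 1 … k`),
  `ineq211_neumann` (sharper: Neumann energy of `T`), `ineq211_levels` (`j = 0 … k`), `ineq211_eta` (verbatim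
  `η`-weights: `Σ_{x∈T_η}Σ_μ η^D|η^{−1}(λ(x+ηe_μ) − λ(x))|² ≥ 8·Σ_{j=1}^k(L^jη)^{−2}Σ_{x∈B^j(Λ_j)}η^D|λ(x)|²`),
  `ineq211_weighted` (the sentence after (2.17): ALL `λ`, `min{a_j, 8}`, `j = 0 … k`, the extra term being (2.14) at
  `η = 1`), and the sentence before (2.11), *"Δ is positive on the subspace N(Q′), hence it is invertible"*:
  `eq_zero_of_gradS_eq_zero` / `eq_zero_of_fwd_eq_zero` (a `λ ∈ N(Q′)` with zero energy vanishes on `T_η` — by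
  (2.11) with `j = 0 … k` and the partition (2.4) `B6Eq24Partition.Domains.biUnion_blk`; the concrete form of `hinj`);
* §3 the torus reading: `inner_negLap_eq_fwd` and `ineq211_torus` (`T = box P`, periodic `λ`:
  `8·Σ_{j=1}^k L^{−2j}Σ_{B^j(Λ_j)}|λ|² ≤ Re Σ_{z∈T_η} conj λ(z)·(Δλ)(z)`).
NOT HERE: the operators `R`, `Δ′_a`, `G′` (`B6SectA`), vector fields / `A ≠ 0`, the separation clause of (2.2); the
two-block counterexample to the printed `π²` is recorded above in prose only (its one-block kernel form is
`B4Block227Sharp`).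
-/


namespace Literature.MathematicalPhysics.QuantumFieldTheory.Balaban1983to89.B6Eq211

open Complex ComplexConjugate
open Literature.MathematicalPhysics.QuantumFieldTheory.Balaban1983to89.B4Green244 (e coarse negLap)
open Literature.MathematicalPhysics.QuantumFieldTheory.Balaban1983to89.B4TwoScaleForm
open Literature.MathematicalPhysics.QuantumFieldTheory.Balaban1983to89.B4TorusPositivity (box IsPeriodic grad_term)
open Literature.MathematicalPhysics.QuantumFieldTheory.Balaban1983to89.B6Eq24Partition

noncomputable section

variable {D : ℕ}

/-! ## §1 The engine: [3, (2.26)–(2.27)] summed over a disjoint family of aligned blocks of several sizes -/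

/-- more region, more bonds: the Neumann energy is monotone in the region. [folklore] -/
private theorem gradS_mono {S T : Finset (Fin D → ℤ)} (h : S ⊆ T) (φ : (Fin D → ℤ) → ℂ) :
    gradS S φ ≤ gradS T φ := by
  unfold gradS dirGrad bonds
  refine Finset.sum_le_sum fun μ _ => Finset.sum_le_sum_of_subset_of_nonneg ?_ fun _ _ _ => by positivity
  intro z hz
  rw [Finset.mem_filter] at hz ⊢
  exact ⟨h hz.1, h hz.2⟩

/-- the Neumann energy of `T` (bonds with both ends in `T`) is at most the forward-bond energy
`Σ_{z∈T} Σ_μ |φ(z+e_μ) − φ(z)|²` (all bonds starting in `T`). [folklore] -/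
private theorem gradS_le_fwd (T : Finset (Fin D → ℤ)) (φ : (Fin D → ℤ) → ℂ) :
    gradS T φ ≤ ∑ z ∈ T, ∑ μ : Fin D, ‖φ (z + e μ) - φ z‖ ^ 2 := by
  unfold gradS dirGrad bonds
  rw [Finset.sum_comm]
  exact Finset.sum_le_sum fun μ _ =>
    Finset.sum_le_sum_of_subset_of_nonneg (Finset.filter_subset _ _) fun _ _ _ => by positivity

/-- **[3, (2.26)–(2.27)] for a disjoint family of aligned blocks of several sizes, all `λ`** (lattice units): for
blocks `B_i = N_i·y_i + [0,N_i)^D ⊆ T`, pairwise disjoint, and real weights `w_i`,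
`Σ_i min{8/N_i², w_iN_i^D}·Σ_{B_i}|λ|² ≤ ⟨λ,(−Δ^N_T)λ⟩ + Σ_i w_i|Σ_{B_i}λ|²` — drop the bonds joining different
blocks ((2.26), `B4TwoScaleForm.sum_gradS_le`) and apply the one-block bound with the repaired gap `8` ((2.27),
`B4TwoScaleForm.cell_bound`) block by block.  This is the shape of the p. 225 sentence *"Δ′_a satisfies the
inequality (2.11) for all λ, with min{a_j, π²} instead of π²"*. [cite: Balaban1984PropagatorsII, (2.11) p.225 ("as it follows from [3, 2.26, and 2.27]")] -/
theorem ablocks_form_lower_bound {ι : Type*} (I : Finset ι) (N : ι → ℕ) (y : ι → Fin D → ℤ) (w : ι → ℝ)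
    (hN : ∀ i ∈ I, 1 ≤ N i) (hdisj : (I : Set ι).PairwiseDisjoint fun i => ablock (N i) (y i))
    {T : Finset (Fin D → ℤ)} (hT : ∀ i ∈ I, ablock (N i) (y i) ⊆ T) (φ : (Fin D → ℤ) → ℂ) :
    ∑ i ∈ I, min (8 / (N i : ℝ) ^ 2) (w i * (N i : ℝ) ^ D) * ∑ x ∈ ablock (N i) (y i), ‖φ x‖ ^ 2
      ≤ gradS T φ + ∑ i ∈ I, w i * ‖∑ x ∈ ablock (N i) (y i), φ x‖ ^ 2 := by
  have hcells : ∀ i ∈ I, min (8 / (N i : ℝ) ^ 2) (w i * (N i : ℝ) ^ D) * ∑ x ∈ ablock (N i) (y i), ‖φ x‖ ^ 2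
      ≤ gradS (ablock (N i) (y i)) φ + w i * ‖∑ x ∈ ablock (N i) (y i), φ x‖ ^ 2 := fun i hi => by
    have h := cell_bound one_pos (w i) (fun ν => (N i : ℤ) * y i ν) (hN i hi) φ
    rw [mul_one, one_mul] at h
    exact h
  have hsum := Finset.sum_le_sum hcells
  rw [Finset.sum_add_distrib] at hsum
  have hU : ∑ i ∈ I, gradS (ablock (N i) (y i)) φ ≤ gradS T φ :=
    (sum_gradS_le I _ hdisj φ).trans (gradS_mono (Finset.biUnion_subset.mpr hT) φ)
  linarith

/-- **[3, (2.26)–(2.27)] for a disjoint family of aligned blocks with VANISHING BLOCK SUMS**: if `Σ_{B_i}λ = 0` for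
every block, then `8·Σ_i N_i^{−2}·Σ_{B_i}|λ|² ≤ ⟨λ,(−Δ^N_T)λ⟩` (the mean-zero Neumann gap `≥ 8/N²` on each block of
side `N`, census G-B4-03). [cite: Balaban1984PropagatorsII, (2.11) p.225 ("as it follows from [3, 2.26, and 2.27]")] -/
theorem ablocks_meanZero_lower_bound {ι : Type*} (I : Finset ι) (N : ι → ℕ) (y : ι → Fin D → ℤ)
    (hN : ∀ i ∈ I, 1 ≤ N i) (hdisj : (I : Set ι).PairwiseDisjoint fun i => ablock (N i) (y i))
    {T : Finset (Fin D → ℤ)} (hT : ∀ i ∈ I, ablock (N i) (y i) ⊆ T) (φ : (Fin D → ℤ) → ℂ)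
    (h0 : ∀ i ∈ I, ∑ x ∈ ablock (N i) (y i), φ x = 0) :
    8 * ∑ i ∈ I, ((N i : ℝ) ^ 2)⁻¹ * ∑ x ∈ ablock (N i) (y i), ‖φ x‖ ^ 2 ≤ gradS T φ := by
  have h := ablocks_form_lower_bound I N y (fun _ => 8) hN hdisj hT φ
  have hmin : ∀ i ∈ I, min (8 / (N i : ℝ) ^ 2) (8 * (N i : ℝ) ^ D) = 8 * ((N i : ℝ) ^ 2)⁻¹ := fun i hi => by
    have h1 : (1 : ℝ) ≤ N i := by exact_mod_cast hN i hi
    rw [div_eq_mul_inv, min_eq_left]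
    have h2 : ((N i : ℝ) ^ 2)⁻¹ ≤ 1 := inv_le_one_of_one_le₀ (one_le_pow₀ h1)
    have h3 : (1 : ℝ) ≤ (N i : ℝ) ^ D := one_le_pow₀ h1
    nlinarith
  have hzero : ∑ i ∈ I, (8 : ℝ) * ‖∑ x ∈ ablock (N i) (y i), φ x‖ ^ 2 = 0 :=
    Finset.sum_eq_zero fun i hi => by rw [h0 i hi, norm_zero, zero_pow two_ne_zero, mul_zero]
  have hlhs : ∑ i ∈ I, min (8 / (N i : ℝ) ^ 2) (8 * (N i : ℝ) ^ D) * ∑ x ∈ ablock (N i) (y i), ‖φ x‖ ^ 2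
      = 8 * ∑ i ∈ I, ((N i : ℝ) ^ 2)⁻¹ * ∑ x ∈ ablock (N i) (y i), ‖φ x‖ ^ 2 := by
    rw [Finset.mul_sum]
    exact Finset.sum_congr rfl fun i hi => by rw [hmin i hi, mul_assoc]
  rw [hzero, add_zero, hlhs] at h
  exact h

/-! ## §2 (2.11) -/

section Ineq

variable (G : Domains D)

/-- **(2.11) with the index `j` running from `0` to `k`** (the level-`0` term vanishes on `N(Q′)` anyway), Neumann
form, lattice units, gap constant `8`: for `λ ∈ N(Q′)`,
`8·Σ_{j=0}^k L^{−2j}·Σ_{x∈B^j(Λ_j)}|λ(x)|² ≤ Σ_{bonds ⊂ T_η}|λ(b₊) − λ(b₋)|²`.  Proof = the printed one: the blocks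
`B^j(y)`, `y ∈ Λ_j`, are pairwise disjoint ((2.4)) with vanishing block sums ((2.7)), so §1 applies.
[cite: Balaban1984PropagatorsII, (2.11) p.225] -/
theorem ineq211_levels (lam' : (Fin D → ℤ) → ℂ) (h : G.NQ lam') :
    8 * ∑ j ∈ Finset.range (G.k + 1), (((G.L : ℝ) ^ j) ^ 2)⁻¹ * ∑ x ∈ G.blk j, ‖lam' x‖ ^ 2
      ≤ gradS G.T lam' := by
  have key := ablocks_meanZero_lower_bound G.cells (fun i => G.L ^ i.1) (fun i => i.2)
    (fun i _ => G.one_le_pow i.1) G.cells_pairwiseDisjoint G.cells_subset_T lam' (by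
      rintro ⟨j, y⟩ hi
      have hj : j < G.k + 1 := Finset.mem_range.mp (Finset.mem_sigma.mp hi).1
      have hy : y ∈ G.lam j := (Finset.mem_sigma.mp hi).2
      exact (qAvg_eq_zero_iff G.one_le_L j y lam').mp (h j (by omega) y hy))
  have hre : ∑ i ∈ G.cells, (((G.L ^ i.1 : ℕ) : ℝ) ^ 2)⁻¹ * ∑ x ∈ ablock (G.L ^ i.1) i.2, ‖lam' x‖ ^ 2
      = ∑ j ∈ Finset.range (G.k + 1), (((G.L : ℝ) ^ j) ^ 2)⁻¹ * ∑ x ∈ G.blk j, ‖lam' x‖ ^ 2 := by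
    unfold Domains.cells
    rw [Finset.sum_sigma]
    refine Finset.sum_congr rfl fun j _ => ?_
    rw [G.sum_blk j, Finset.mul_sum]
    push_cast
    rfl
  rw [hre] at key
  exact key

/-- **(2.11), Neumann form** (printed range `j = 1, …, k`; lattice units; gap constant `8` for the printed `π²`, see the
module docstring): for every `λ ∈ N(Q′)`,
`8·Σ_{j=1}^k L^{−2j}·Σ_{x∈B^j(Λ_j)}|λ(x)|² ≤ Σ_{bonds b ⊂ T_η}|λ(b₊) − λ(b₋)|²` — already the bonds with both ends in
`T_η` suffice. [cite: Balaban1984PropagatorsII, (2.11) p.225] -/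
theorem ineq211_neumann (lam' : (Fin D → ℤ) → ℂ) (h : G.NQ lam') :
    8 * ∑ j ∈ Finset.Icc 1 G.k, (((G.L : ℝ) ^ j) ^ 2)⁻¹ * ∑ x ∈ G.blk j, ‖lam' x‖ ^ 2
      ≤ gradS G.T lam' := by
  refine le_trans ?_ (ineq211_levels G lam' h)
  refine mul_le_mul_of_nonneg_left (Finset.sum_le_sum_of_subset_of_nonneg ?_ fun j _ _ => ?_) (by norm_num)
  · intro j hj
    rw [Finset.mem_Icc] at hj
    exact Finset.mem_range.mpr (by omega)
  · exact mul_nonneg (inv_nonneg.mpr (by positivity)) (Finset.sum_nonneg fun _ _ => by positivity)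

/-- **(2.11)** p. 225 [PDF 3] (lattice units `η = 1`; the `η`-weighted verbatim form is `ineq211_eta`; gap constant
`8` for the printed `π²`): for every `λ ∈ N(Q′)`,
`⟨λ, Δλ⟩ = Σ_{x∈T_η}Σ_μ|λ(x+e_μ) − λ(x)|² ≥ 8·Σ_{j=1}^k (L^j)^{−2}·Σ_{x∈B^j(Λ_j)}|λ(x)|²`
(every bond of the torus `T_η` counted once, cf. `inner_negLap_eq_fwd`). [cite: Balaban1984PropagatorsII, (2.11) p.225] -/
theorem ineq211 (lam' : (Fin D → ℤ) → ℂ) (h : G.NQ lam') :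
    8 * ∑ j ∈ Finset.Icc 1 G.k, (((G.L : ℝ) ^ j) ^ 2)⁻¹ * ∑ x ∈ G.blk j, ‖lam' x‖ ^ 2
      ≤ ∑ z ∈ G.T, ∑ μ : Fin D, ‖lam' (z + e μ) - lam' z‖ ^ 2 :=
  (ineq211_neumann G lam' h).trans (gradS_le_fwd G.T lam')

/-- **(2.11) VERBATIM, with the `η`-weights of [4] (1.4)/(1.21)** (`⟨λ,Δλ⟩ = Σ_b η^d|η^{−1}(λ(b₊) − λ(b₋))|²`,
`‖λ‖²_{B^j(Λ_j)} = Σ η^d|λ(x)|²`; any `η > 0`, in print `η = L^{−k}`; gap constant `8` for `π²`): for `λ ∈ N(Q′)`,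
`Σ_{x∈T_η}Σ_μ η^D|η^{−1}(λ(x+ηe_μ) − λ(x))|² ≥ 8·Σ_{j=1}^k (L^jη)^{−2}·Σ_{x∈B^j(Λ_j)} η^D|λ(x)|²`.
[cite: Balaban1984PropagatorsII, (2.11) p.225] -/
theorem ineq211_eta (η : ℝ) (hη : 0 < η) (lam' : (Fin D → ℤ) → ℂ) (h : G.NQ lam') :
    8 * ∑ j ∈ Finset.Icc 1 G.k, (((G.L : ℝ) ^ j * η) ^ 2)⁻¹ * ∑ x ∈ G.blk j, η ^ D * ‖lam' x‖ ^ 2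
      ≤ ∑ z ∈ G.T, η ^ D * ∑ μ : Fin D, ‖η⁻¹ • (lam' (z + e μ) - lam' z)‖ ^ 2 := by
  have key := mul_le_mul_of_nonneg_left (ineq211 G lam' h) (show (0 : ℝ) ≤ η ^ D * (η ^ 2)⁻¹ by positivity)
  have hterm : ∀ j : ℕ, (((G.L : ℝ) ^ j * η) ^ 2)⁻¹ * ∑ x ∈ G.blk j, η ^ D * ‖lam' x‖ ^ 2
      = η ^ D * (η ^ 2)⁻¹ * ((((G.L : ℝ) ^ j) ^ 2)⁻¹ * ∑ x ∈ G.blk j, ‖lam' x‖ ^ 2) := fun j => by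
    rw [← Finset.mul_sum, mul_pow, mul_inv]
    ring
  have lhs : η ^ D * (η ^ 2)⁻¹ * (8 * ∑ j ∈ Finset.Icc 1 G.k, (((G.L : ℝ) ^ j) ^ 2)⁻¹ * ∑ x ∈ G.blk j, ‖lam' x‖ ^ 2)
      = 8 * ∑ j ∈ Finset.Icc 1 G.k, (((G.L : ℝ) ^ j * η) ^ 2)⁻¹ * ∑ x ∈ G.blk j, η ^ D * ‖lam' x‖ ^ 2 := by
    rw [Finset.sum_congr rfl fun j _ => hterm j, ← Finset.mul_sum]
    ring
  have rhs : η ^ D * (η ^ 2)⁻¹ * ∑ z ∈ G.T, ∑ μ : Fin D, ‖lam' (z + e μ) - lam' z‖ ^ 2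
      = ∑ z ∈ G.T, η ^ D * ∑ μ : Fin D, ‖η⁻¹ • (lam' (z + e μ) - lam' z)‖ ^ 2 := by
    rw [Finset.mul_sum]
    refine Finset.sum_congr rfl fun z _ => ?_
    rw [mul_assoc, Finset.mul_sum]
    congr 1
    refine Finset.sum_congr rfl fun μ _ => ?_
    rw [norm_smul, norm_inv, Real.norm_eq_abs, abs_of_pos hη, mul_pow, inv_pow]
  rw [lhs, rhs] at key
  exact key

/-- **The sentence after (2.17)** p. 225, verbatim: *"Δ′_a satisfies the inequality (2.11) for all λ, with min{a_j, π²}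
instead of π² and the index j running from 0 to k on the right-hand side"* — PROVED with `8` for `π²`, in lattice
units: for EVERY `λ` and all real `a_j`,
`Σ_{j=0}^k min{8, a_j}L^{−2j}·Σ_{x∈B^j(Λ_j)}|λ(x)|² ≤ Σ_{bonds⊂T_η}|λ(b₊) − λ(b₋)|² + Σ_{j=0}^k Σ_{y∈Λ_j} a_jL^{−2j}·L^{−jD}
|Σ_{x∈B^j(y)}λ(x)|²`, the last term being `⟨λ, Q′*aQ′λ⟩ = Σ_{j=0}^kΣ_{y∈Λ_j} a_j(L^jη)^{d−2}|(Q′_jλ)(y)|²` of (2.14) at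
`η = 1` (`(Q′_jλ)(y) = L^{−jD}Σ_{B^j(y)}λ`). [cite: Balaban1984PropagatorsII, p.225 (sentence after (2.17)), (2.14) p.225] -/
theorem ineq211_weighted (a : ℕ → ℝ) (lam' : (Fin D → ℤ) → ℂ) :
    ∑ j ∈ Finset.range (G.k + 1), min 8 (a j) * (((G.L : ℝ) ^ j) ^ 2)⁻¹ * ∑ x ∈ G.blk j, ‖lam' x‖ ^ 2
      ≤ gradS G.T lam'
        + ∑ j ∈ Finset.range (G.k + 1), ∑ y ∈ G.lam j,
            a j * (((G.L : ℝ) ^ j) ^ 2)⁻¹ * ((((G.L : ℝ) ^ j) ^ D)⁻¹ * ‖∑ x ∈ ablock (G.L ^ j) y, lam' x‖ ^ 2) := by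
  have key := ablocks_form_lower_bound G.cells (fun i => G.L ^ i.1) (fun i => i.2)
    (fun i => a i.1 * (((G.L : ℝ) ^ i.1) ^ 2)⁻¹ * (((G.L : ℝ) ^ i.1) ^ D)⁻¹)
    (fun i _ => G.one_le_pow i.1) G.cells_pairwiseDisjoint G.cells_subset_T lam'
  have hL : ∀ j : ℕ, (0 : ℝ) < (G.L : ℝ) ^ j := fun j => by
    have : (0 : ℝ) < G.L := by exact_mod_cast G.one_le_L
    positivity
  have hmin : ∀ i : (Σ _ : ℕ, Fin D → ℤ),
      min (8 / (((G.L ^ i.1 : ℕ) : ℝ)) ^ 2)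
        (a i.1 * (((G.L : ℝ) ^ i.1) ^ 2)⁻¹ * (((G.L : ℝ) ^ i.1) ^ D)⁻¹ * (((G.L ^ i.1 : ℕ) : ℝ)) ^ D)
        = min 8 (a i.1) * (((G.L : ℝ) ^ i.1) ^ 2)⁻¹ := fun i => by
    push_cast
    have h2 : (0 : ℝ) < ((G.L : ℝ) ^ i.1) ^ 2 := pow_pos (hL _) 2
    have hD : (((G.L : ℝ) ^ i.1) ^ D)⁻¹ * ((G.L : ℝ) ^ i.1) ^ D = 1 := inv_mul_cancel₀ (pow_pos (hL _) D).ne'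
    rw [mul_assoc, hD, mul_one, div_eq_mul_inv, min_mul_of_nonneg _ _ (inv_nonneg.mpr h2.le)]
  have lhs : ∑ i ∈ G.cells, min (8 / (((G.L ^ i.1 : ℕ) : ℝ)) ^ 2)
        (a i.1 * (((G.L : ℝ) ^ i.1) ^ 2)⁻¹ * (((G.L : ℝ) ^ i.1) ^ D)⁻¹ * (((G.L ^ i.1 : ℕ) : ℝ)) ^ D)
        * ∑ x ∈ ablock (G.L ^ i.1) i.2, ‖lam' x‖ ^ 2
      = ∑ j ∈ Finset.range (G.k + 1), min 8 (a j) * (((G.L : ℝ) ^ j) ^ 2)⁻¹ * ∑ x ∈ G.blk j, ‖lam' x‖ ^ 2 := by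
    rw [Finset.sum_congr rfl fun i _ => by rw [hmin i]]
    unfold Domains.cells
    rw [Finset.sum_sigma]
    refine Finset.sum_congr rfl fun j _ => ?_
    rw [G.sum_blk j, Finset.mul_sum]
  have rhs : ∑ i ∈ G.cells, a i.1 * (((G.L : ℝ) ^ i.1) ^ 2)⁻¹ * (((G.L : ℝ) ^ i.1) ^ D)⁻¹
        * ‖∑ x ∈ ablock (G.L ^ i.1) i.2, lam' x‖ ^ 2
      = ∑ j ∈ Finset.range (G.k + 1), ∑ y ∈ G.lam j,
            a j * (((G.L : ℝ) ^ j) ^ 2)⁻¹ * ((((G.L : ℝ) ^ j) ^ D)⁻¹ * ‖∑ x ∈ ablock (G.L ^ j) y, lam' x‖ ^ 2) := by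
    unfold Domains.cells
    rw [Finset.sum_sigma]
    refine Finset.sum_congr rfl fun j _ => Finset.sum_congr rfl fun y _ => ?_
    ring
  rw [lhs, rhs] at key
  exact key

/-- **"the Laplace operator Δ is positive on the subspace N(Q′), hence it is invertible on this subspace"** (p. 225,
the sentence (2.11) quantifies): a `λ ∈ N(Q′)` whose Neumann energy on `T_η` vanishes, vanishes on `T_η` — by
`ineq211_levels` every `Σ_{B^j(Λ_j)}|λ|²` is `0`, and the `B^j(Λ_j)` cover `T_η` ((2.4)).  This is the concrete form of
the hypothesis `hinj` of `B6SectA.orbitMinimiser_unique` (uniqueness of the minimum (2.12) on each orbit).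
[cite: Balaban1984PropagatorsII, p.225 (sentence before (2.11))] -/
theorem eq_zero_of_gradS_eq_zero (lam' : (Fin D → ℤ) → ℂ) (h : G.NQ lam') (h0 : gradS G.T lam' = 0) :
    ∀ x ∈ G.T, lam' x = 0 := by
  have key := ineq211_levels G lam' h
  rw [h0] at key
  have hL : ∀ j : ℕ, (0 : ℝ) < (((G.L : ℝ) ^ j) ^ 2)⁻¹ := fun j => by
    have : (0 : ℝ) < G.L := by exact_mod_cast G.one_le_L
    positivity
  have hnn : ∀ j ∈ Finset.range (G.k + 1), 0 ≤ (((G.L : ℝ) ^ j) ^ 2)⁻¹ * ∑ x ∈ G.blk j, ‖lam' x‖ ^ 2 :=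
    fun j _ => mul_nonneg (hL j).le (Finset.sum_nonneg fun _ _ => by positivity)
  have hsum : ∑ j ∈ Finset.range (G.k + 1), (((G.L : ℝ) ^ j) ^ 2)⁻¹ * ∑ x ∈ G.blk j, ‖lam' x‖ ^ 2 = 0 :=
    le_antisymm (by linarith) (Finset.sum_nonneg hnn)
  intro x hx
  rw [← G.biUnion_blk, Finset.mem_biUnion] at hx
  obtain ⟨j, hj, hxj⟩ := hx
  have hj0 := (Finset.sum_eq_zero_iff_of_nonneg hnn).mp hsum j hj
  have hblk : ∑ x ∈ G.blk j, ‖lam' x‖ ^ 2 = 0 := by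
    rcases mul_eq_zero.mp hj0 with h1 | h1
    · exact absurd h1 (hL j).ne'
    · exact h1
  have := (Finset.sum_eq_zero_iff_of_nonneg fun _ _ => by positivity).mp hblk x hxj
  rwa [sq_eq_zero_iff, norm_eq_zero] at this

/-- The same with the torus/forward energy: `λ ∈ N(Q′)` and `Σ_{x∈T_η}Σ_μ|λ(x+e_μ) − λ(x)|² = 0` force `λ = 0` on
`T_η` (*"Δ is positive on the subspace N(Q′)"*). [cite: Balaban1984PropagatorsII, p.225 (sentence before (2.11))] -/
theorem eq_zero_of_fwd_eq_zero (lam' : (Fin D → ℤ) → ℂ) (h : G.NQ lam')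
    (h0 : ∑ z ∈ G.T, ∑ μ : Fin D, ‖lam' (z + e μ) - lam' z‖ ^ 2 = 0) : ∀ x ∈ G.T, lam' x = 0 :=
  eq_zero_of_gradS_eq_zero G lam' h
    (le_antisymm (h0 ▸ gradS_le_fwd G.T lam') (gradS_nonneg G.T lam'))

end Ineq

/-! ## §3 The torus reading: on a period box the forward-bond energy is `⟨λ, Δλ⟩` -/

/-- On the torus `T_η = Π_μ ℤ/P_μ` (period box `box P`, `P`-periodic `λ`): `Σ_{z∈box P} conj λ(z)·(Δλ)(z) =
Σ_{z∈box P}Σ_μ|λ(z+e_μ) − λ(z)|²` with `Δ = B4Green244.negLap 1 = −`(lattice Laplacian) in lattice units — [4] (1.21)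
*"Δ is η-lattice Laplace operator for scalar functions"*, `⟨λ,Δλ⟩ = ⟨∂λ,∂λ⟩`, every bond of the torus counted once
(periodic summation by parts, `B4TorusPositivity.grad_term`). [cite: Balaban1984PropagatorsI, (1.21) p.21] -/
theorem inner_negLap_eq_fwd {d : ℕ} {P : Fin (d + 1) → ℕ} (hP : ∀ i, 1 ≤ P i)
    {lam' : (Fin (d + 1) → ℤ) → ℂ} (hper : IsPeriodic P lam') :
    ∑ z ∈ box P, conj (lam' z) * negLap 1 lam' z
      = ((∑ z ∈ box P, ∑ μ : Fin (d + 1), ‖lam' (z + e μ) - lam' z‖ ^ 2 : ℝ) : ℂ) := by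
  unfold negLap
  push_cast
  simp only [one_pow, one_mul]
  calc ∑ z ∈ box P, conj (lam' z) * ∑ μ : Fin (d + 1), (2 * lam' z - lam' (z + e μ) - lam' (z - e μ))
      = ∑ μ : Fin (d + 1), ∑ z ∈ box P, conj (lam' z) * (2 * lam' z - lam' (z + e μ) - lam' (z - e μ)) := by
        rw [Finset.sum_comm]
        exact Finset.sum_congr rfl fun z _ => Finset.mul_sum _ _ _
    _ = ∑ μ : Fin (d + 1), ∑ z ∈ box P, ((‖lam' (z + e μ) - lam' z‖ : ℝ) : ℂ) ^ 2 :=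
        Finset.sum_congr rfl fun μ _ => grad_term hP hper μ
    _ = _ := Finset.sum_comm

/-- **(2.11) ON THE TORUS `T_η = Π_μ ℤ/P_μ`** (`T = box P`, `P`-periodic `λ ∈ N(Q′)`, lattice units, gap constant `8`
for `π²`): `8·Σ_{j=1}^k L^{−2j}·Σ_{x∈B^j(Λ_j)}|λ(x)|² ≤ ⟨λ, Δλ⟩_{T_η} = Re Σ_{z∈T_η} conj λ(z)·(Δλ)(z)`.
[cite: Balaban1984PropagatorsII, (2.11) p.225] -/
theorem ineq211_torus {d : ℕ} (G : Domains (d + 1)) {P : Fin (d + 1) → ℕ} (hP : ∀ i, 1 ≤ P i)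
    (hT : G.T = box P) (lam' : (Fin (d + 1) → ℤ) → ℂ) (hper : IsPeriodic P lam') (h : G.NQ lam') :
    8 * ∑ j ∈ Finset.Icc 1 G.k, (((G.L : ℝ) ^ j) ^ 2)⁻¹ * ∑ x ∈ G.blk j, ‖lam' x‖ ^ 2
      ≤ (∑ z ∈ box P, conj (lam' z) * negLap 1 lam' z).re := by
  rw [inner_negLap_eq_fwd hP hper, Complex.ofReal_re, ← hT]
  exact ineq211 G lam' h

end

end Literature.MathematicalPhysics.QuantumFieldTheory.Balaban1983to89.B6Eq211


/-! # Part II — the abstract `BlockSystem` carrier (r03 gen 2, p242700, ACCEPTED commit b28c7a294c78), RESTORED VERBATIM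

Lead rulings G.5-28 / G.5-31 / G.5-35 (HOME/STATUS.md 2026-08-21T00:40Z–01:00Z): this path held r03 gen 2's p242700
(`BlockSystem.ineq211_eight`, `BlockSystem.ineq211_sharp`, `BlockSystem.eq_zero_of_form_eq_zero`, `not_ineq211_pi_sq`, …,
file of record for SKELETON row B6.Eq2.11) when seat p03's p243617 (Part I above: the same inequality on the concrete
label carrier of `…B6Eq24Partition`) was applied on the same path as a new version; the gate keeps one head per path, so the
two independent proofs are merged here append-only: Part I = p03 p243617 verbatim, Part II = r03 p242700 verbatim (its module
docstring follows as a section docstring; its imports moved to the top).  No declaration of either part is renamed or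
deleted; the namespaces coincide (`…B6Eq211`) and no short name clashes.
-/

/-!
# `Balaban1983to89.B6Eq211` — T. Bałaban, *Propagators and renormalization transformations for lattice gauge
theories. II*, Commun. Math. Phys. **96** (1984) 223–250 [Balaban1984PropagatorsII]: the multiscale Poincaré
inequality (2.11) on the gauge space N(Q′) — PROVED with the lattice constant 8 (and blockwise with the sharp Neumann
gap `4s²sin²(π/2s)`), the printed constant `π²` REFUTED by a kernel-checked two-block configuration

statement-level skeleton of published theorems with citation tags; proofs where landed; nothing here is a claim about the Yang–Mills mass gap.
PDF held: `paper:balaban1984-cmp96-propagators-rt-ii` (journal page = PDF page + 222); pp. 224–225 [PDF 2–3] read from the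
×2 renders `run/shared/lean/pub/pub-balaban/b2b-balaban-ref1/pages/1984-cmp96-propagators-rt-II/…-p002/p003-x2.png`.

CITATION HEADER (cell `lit-balaban`, unit `lit-balaban-r03` gen 2, Phase-2 envelope seat p03 of `HOME/PHASE2-TARGETS.md`
§G.3; SKELETON row `B6.Eq2.11` of `HOME/lit-balaban-r03/ROWS-B6.md`).  IMPORTED, not modified: `…B4Block227`
(`sum_sq_le_of_sum_eq_zero_coordCube8`: the mean-zero Poincaré inequality on the coordinate cube `{0,…,n}^d` with the
constant `(n+1)²/8`) and `…B4Block227Sharp` (`poincare_coordCube_sharp`, `gap_eq`, `eight_le_gap`, `gap_lt_pi_sq`: the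
sharp Neumann gap `4s²sin²(π/2s) ∈ [8, π²[` of a block of side `s`), both written for [3] = B4 (2.26)–(2.27), which is
exactly the source the paper cites for (2.11).
WHAT THE PAPER PRINTS (p. 224–225, verbatim): (2.1)–(2.4) *"Ω₁ ⊃ Ω₂ ⊃ … ⊃ Ω_k, Ω_j ⊂ T_η … Ω_j = B^j(Ω_j^{(j)}),
Ω_j^{(j)} ⊂ T^{(j)}_{L^jη} … Λ_j = Ω_j^{(j)}∖Ω_{j+1}^{(j)}, j = 1, …, k − 1, Λ_k = Ω_k^{(k)}, Λ₀ = Ω₁^c (2.3) …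
Ω₁ = ⋃_{j=1}^k B^j(Λ_j), T = ⋃_{j=0}^k B^j(Λ_j), where B⁰(Λ₀) = Λ₀. (2.4)"*; (2.7) *"gauge transformations
λ : A → A^λ = A − ∂λ such that λ = 0 on Λ₀, Q′_jλ = 0 on Λ_j, j = 1, …, k. (2.7)"*; (2.10) *"N(Q′) = {λ : λ satisfies
(2.7)}"*; p. 225: *"the Laplace operator Δ is positive on the subspace N(Q′), hence it is invertible on this subspace.
More exactly we have the inequality ⟨λ, Δλ⟩ ≥ π² Σ_{j=1}^k (L^jη)^{−2} Σ_{x∈B^j(Λ_j)} η^d|λ(x)|², λ ∈ N(Q′), (2.11) as it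
follows from [3, 2.26, and 2.27]."*  Here `Δ = ∂*∂` with `(∂λ)(b) = η⁻¹(λ(b₊) − λ(b₋))` and `⟨f, g⟩ = Σ_x η^d f(x)g(x)`
([4] (1.21)), so `⟨λ, Δλ⟩ = ‖∂λ‖² = Σ_{b⊂T_η} η^{d−2}|λ(b₊) − λ(b₋)|²`; `Q′_j` is the block mean over `B^j(y)` ([3] (1.1)),
and `B^j(y)`, `y ∈ Λ_j ⊂ T^{(j)}_{L^jη}`, is a cube of `L^j` sites per direction of the η-lattice.
WHAT IS PROVED HERE (0 sorry, 0 named facts), over the carrier `BlockSystem` = the η-lattice T (sites `ι`, bonds `κ`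
with end-points `src`/`tgt`), the set `Λ₀` and the finite family (`β`) of the blocks `B^j(y)`, `y ∈ Λ_j`, `j ≥ 1`, each
CHARTED by a coordinate cube `{0,…,n_b}^d` (`n_b + 1 = L^j` sites per direction; charts injective, blocks pairwise
disjoint, the `d·n_b(n_b+1)^{d−1}` internal nearest-neighbour steps of a block listed among the bonds of T):
(i) `sum_blocks_le_form` — `⟨λ, Δλ⟩ ≥ Σ_b Σ_{internal bonds of b} η^{d−2}|λ(b₊) − λ(b₋)|²` (drop the other bonds; the
internal-bond lists of distinct blocks are disjoint);
(ii) **`ineq211_eight`** — (2.11) WITH THE CONSTANT 8 IN PLACE OF π²: for every `λ ∈ N(Q′)`,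
`⟨λ, Δλ⟩ ≥ 8·Σ_b ((n_b+1)η)^{−2} Σ_{x∈b} η^d|λ(x)|²` (per block: mean zero + `B4Block227` at constant `(n+1)²/8`);
(iii) `ineq211_sharp` — the same with the blockwise sharp constants `4(n_b+1)²sin²(π/(2(n_b+1))) ∈ [8, π²[`;
(iv) `eq_zero_of_form_eq_zero` — *"Δ is positive on N(Q′), hence invertible"*: under the cover (2.4)
`T = Λ₀ ∪ ⋃ blocks`, `λ ∈ N(Q′)` and `⟨λ, Δλ⟩ = 0` force `λ = 0` (this is the hypothesis `hinj` of
`B6SectA.orbitMinimiser_unique`, now a theorem on every block system);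
(v) **`not_ineq211_pi_sq`** — THE PRINTED CONSTANT π² IS REFUTED: on the 4 × 2 torus (d = 2, η = 1, k = 1, Λ₀ = ∅, two
blocks of side L = 2) the configuration λ(x) = (1, −1, −1, 1)(x₁) lies in N(Q′), has ⟨λ, Δλ⟩ = 16 and
Σ_b (2η)^{−2}Σ_{x∈b}η²|λ(x)|² = 2, and 16 < 2π²; on that block system `Ineq211 c ↔ c ≤ 8` (`ineq211_fourByTwo_iff`),
so 8 is the best universal constant.  LOCATED CAUSE: (2.11) inherits the slip of [3] (2.27) (census G-B4-03,
`B4.Display227Printed` vs `Display227Repaired`, `B4Block227Sharp.not_display227Printed_pi_sq`): π² is the continuum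
Neumann gap of the unit cube; the lattice block of `s ≥ 2` sites per direction has gap `4s²sin²(π/2s) ∈ [8, π²[`.
HARMLESS for the paper: (2.11) is used only qualitatively (positivity of Δ on N(Q′), existence of G′ = Δ′_a⁻¹, p. 225)
and through O(1) constants.
NOT modelled here: the blocks are abstract charts (any family of disjoint charted cubes inside any bond system), not
tied to the nested geometry (2.1)–(2.2) — (2.11) needs nothing of (2.2); the tori `T^{(j)}` of `…Setup`/`TorusGeometry`
are one admissible instance, the explicit 4 × 2 torus of §4 another.
-/

namespace Literature.MathematicalPhysics.QuantumFieldTheory.Balaban1983to89.B6Eq211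

open Finset Real
open Beta.CoordCubePoincare (stepUp)

noncomputable section

/-! ## §1. The carrier: a bond system with a family of charted, pairwise disjoint blocks -/

/-- **The data of (2.1)–(2.4), (2.7) needed by (2.11).**  `ι` = the sites of `T_η`, `κ` = its bonds (`src b = b₋`,
`tgt b = b₊`), `η` = the lattice spacing, `d` = the dimension, `zeroSet` = `Λ₀ = Ω₁^c` (where λ = 0), and the blocks
`B^j(y)`, `y ∈ Λ_j`, `j = 1, …, k`, indexed by `b : β`: `side b + 1 = L^j` sites per direction, `chart b` = the
coordinate cube `{0,…,side b}^d → B^j(y) ⊂ T_η` (injective; distinct blocks disjoint), `bond b μ y` = the bond of `T_η`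
from `chart b y` to `chart b (y + e_μ)` (an internal nearest-neighbour step of the block, `y_μ < side b`).
[cite: Balaban1984PropagatorsII, (2.1)–(2.4), (2.7) p.224] -/
structure BlockSystem (ι κ β : Type*) where
  /-- dimension `d` of the lattice -/
  d : ℕ
  /-- lattice spacing `η > 0` -/
  η : ℝ
  /-- `b₋` -/
  src : κ → ι
  /-- `b₊` -/
  tgt : κ → ι
  /-- `Λ₀ = Ω₁^c` (2.3): the sites where the gauge functions vanish, (2.7) -/
  zeroSet : Set ι
  /-- block `b = B^j(y)` has `side b + 1 = L^j` sites per direction -/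
  side : β → ℕ
  /-- the coordinate chart of the block -/
  chart : (b : β) → (Fin d → Fin (side b + 1)) → ι
  /-- the internal bond from `chart b y` to `chart b (y + e_μ)` (meaningful for `y μ ≠ last`) -/
  bond : (b : β) → Fin d → (Fin d → Fin (side b + 1)) → κ
  η_pos : 0 < η
  chart_injective : ∀ b, Function.Injective (chart b)
  chart_disjoint : ∀ b b', b ≠ b' → ∀ y y', chart b y ≠ chart b' y'
  src_bond : ∀ b μ y, y μ ≠ Fin.last (side b) → src (bond b μ y) = chart b y
  tgt_bond : ∀ b μ y, y μ ≠ Fin.last (side b) → tgt (bond b μ y) = chart b (stepUp y μ)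

namespace BlockSystem

variable {ι κ β : Type*} (S : BlockSystem ι κ β)

/-- **`⟨λ, Δλ⟩ = ‖∂λ‖² = Σ_{b⊂T_η} η^{d−2}|λ(b₊) − λ(b₋)|²`** (Δ = ∂*∂, ∂ = η⁻¹·difference, ⟨f,g⟩ = Σ η^d fg; the factor
is written `η^d/η²`). [cite: Balaban1984PropagatorsII, (2.8)–(2.11) pp.224–225] -/
def form [Fintype κ] (lam : ι → ℝ) : ℝ :=
  ∑ k, S.η ^ S.d / S.η ^ 2 * (lam (S.tgt k) - lam (S.src k)) ^ 2

/-- the block mass `Σ_{x∈B^j(y)} η^d|λ(x)|²` of (2.11). [cite: Balaban1984PropagatorsII, (2.11) p.225] -/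
def blockMass (lam : ι → ℝ) (b : β) : ℝ := ∑ y, S.η ^ S.d * lam (S.chart b y) ^ 2

/-- **N(Q′)** (2.7)/(2.10): `λ = 0 on Λ₀` and `Q′_jλ = 0 on Λ_j`, i.e. the mean of `λ` over every block `B^j(y)`,
`y ∈ Λ_j`, `j ≥ 1`, vanishes (block SUM = 0). [cite: Balaban1984PropagatorsII, (2.7) p.224, (2.10) p.225] -/
def InGaugeSpace (lam : ι → ℝ) : Prop :=
  (∀ x ∈ S.zeroSet, lam x = 0) ∧ ∀ b, ∑ y, lam (S.chart b y) = 0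

/-- **(2.11) with a constant `c`** (printed: `c = π²`): `⟨λ, Δλ⟩ ≥ c Σ_{j=1}^k (L^jη)^{−2} Σ_{x∈B^j(Λ_j)} η^d|λ(x)|²`
for all `λ ∈ N(Q′)` — the sum over `j` and over the blocks `B^j(y) ⊂ B^j(Λ_j)` being one sum over `b : β` with
`L^j = side b + 1`. [cite: Balaban1984PropagatorsII, (2.11) p.225] -/
def Ineq211 [Fintype κ] [Fintype β] (c : ℝ) : Prop :=
  ∀ lam : ι → ℝ, S.InGaugeSpace lam →
    c * ∑ b, S.blockMass lam b / (((S.side b : ℝ) + 1) * S.η) ^ 2 ≤ S.form lam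

/-! ## §2. Dropping the non-internal bonds: `⟨λ, Δλ⟩ ≥ Σ_blocks Σ_internal bonds` -/

/-- the internal steps `(μ, y)` of block `b` (`y_μ < side b`). [cite: Balaban1984PropagatorsII, (2.11) p.225] -/
def adm (b : β) : Finset (Fin S.d × (Fin S.d → Fin (S.side b + 1))) :=
  univ.filter fun p => p.2 p.1 ≠ Fin.last (S.side b)

omit S in
/-- in `Fin (n+1)`, `stepUp` in two different directions from the same admissible point gives different points.
[folklore] -/
private theorem stepUp_ne_of_ne {d n : ℕ} {y : Fin d → Fin (n + 1)} {μ μ' : Fin d} (hμ : y μ ≠ Fin.last n)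
    (hne : μ ≠ μ') : stepUp y μ ≠ stepUp y μ' := by
  intro h
  have h1 : stepUp y μ μ = stepUp y μ' μ := by rw [h]
  simp only [stepUp, Function.update_self, Function.update_of_ne hne] at h1
  -- `y μ + 1 = y μ` forces `n = 0`, contradicting `y μ ≠ last`
  have h2 : (1 : Fin (n + 1)) = 0 := by
    have := h1
    rwa [add_eq_left] at this
  rw [Fin.one_eq_zero_iff] at h2
  have hn : n = 0 := by omega
  subst hn
  apply hμ
  ext
  have hlt := (y μ).isLt
  simp only [Fin.val_last]
  omega

/-- the internal bonds of ONE block are listed injectively (API for (2.11): charts injective + `stepUp`).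
[cite: Balaban1984PropagatorsII, (2.11) p.225] -/
theorem bond_injOn (b : β) :
    Set.InjOn (fun p : Fin S.d × (Fin S.d → Fin (S.side b + 1)) => S.bond b p.1 p.2) ↑(S.adm b) := by
  intro p hp q hq h
  simp only [adm, coe_filter, mem_univ, true_and, Set.mem_setOf_eq] at hp hq
  have h : S.bond b p.1 p.2 = S.bond b q.1 q.2 := h
  have hs : S.chart b p.2 = S.chart b q.2 := by rw [← S.src_bond b p.1 p.2 hp, ← S.src_bond b q.1 q.2 hq, h]
  have h2 : p.2 = q.2 := S.chart_injective b hs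
  have ht : S.chart b (stepUp p.2 p.1) = S.chart b (stepUp q.2 q.1) := by
    rw [← S.tgt_bond b p.1 p.2 hp, ← S.tgt_bond b q.1 q.2 hq, h]
  have h3 := S.chart_injective b ht
  rw [h2] at h3 hp
  have h1 : p.1 = q.1 := by
    by_contra hne
    exact stepUp_ne_of_ne hp hne h3
  exact Prod.ext h1 h2

variable [Fintype β]

/-- the internal bonds of ALL blocks are listed injectively (distinct blocks are disjoint; API for (2.11)).
[cite: Balaban1984PropagatorsII, (2.11) p.225] -/
theorem bond_sigma_injOn :
    Set.InjOn (fun t : (Σ b, Fin S.d × (Fin S.d → Fin (S.side b + 1))) => S.bond t.1 t.2.1 t.2.2)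
      ↑(univ.sigma fun b => S.adm b : Finset (Σ b, Fin S.d × (Fin S.d → Fin (S.side b + 1)))) := by
  classical
  rintro ⟨b, p⟩ hp ⟨b', q⟩ hq h
  simp only [coe_sigma, Set.mem_sigma_iff, coe_univ, Set.mem_univ, true_and] at hp hq
  have h : S.bond b p.1 p.2 = S.bond b' q.1 q.2 := h
  by_cases hbb : b = b'
  · subst hbb
    have := S.bond_injOn b hp hq h
    rw [this]
  · exfalso
    have hp' : p.2 p.1 ≠ Fin.last _ := by simpa [adm] using hp
    have hq' : q.2 q.1 ≠ Fin.last _ := by simpa [adm] using hq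
    have hs : S.chart b p.2 = S.chart b' q.2 := by
      rw [← S.src_bond b p.1 p.2 hp', ← S.src_bond b' q.1 q.2 hq', h]
    exact S.chart_disjoint b b' hbb p.2 q.2 hs

variable [Fintype κ]

/-- the internal energy of one block, written over its chart: `Σ_μ Σ_{y_μ<side} |λ(chart(y+e_μ)) − λ(chart y)|²`.
[cite: Balaban1984PropagatorsII, (2.11) p.225] -/
def blockEnergy (lam : ι → ℝ) (b : β) : ℝ :=
  ∑ μ : Fin S.d, ∑ y ∈ univ.filter (fun y : Fin S.d → Fin (S.side b + 1) => y μ ≠ Fin.last (S.side b)),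
    (lam (S.chart b (stepUp y μ)) - lam (S.chart b y)) ^ 2

omit [Fintype κ] [Fintype β] in
/-- the block energy as a sum over the admissible steps (API for (2.11)). [cite: Balaban1984PropagatorsII, (2.11) p.225] -/
theorem blockEnergy_eq_sum_adm (lam : ι → ℝ) (b : β) :
    S.blockEnergy lam b = ∑ p ∈ S.adm b,
      (lam (S.tgt (S.bond b p.1 p.2)) - lam (S.src (S.bond b p.1 p.2))) ^ 2 := by
  rw [blockEnergy, adm, Finset.sum_filter, Fintype.sum_prod_type]
  refine Finset.sum_congr rfl fun μ _ => ?_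
  rw [Finset.sum_filter]
  refine Finset.sum_congr rfl fun y _ => ?_
  by_cases hy : y μ ≠ Fin.last (S.side b)
  · rw [if_pos hy, if_pos hy, S.src_bond b μ y hy, S.tgt_bond b μ y hy]
  · rw [if_neg hy, if_neg hy]

omit [Fintype β] [Fintype κ] in
/-- `η^d/η² ≥ 0` (API for (2.11)). [cite: Balaban1984PropagatorsII, (2.11) p.225] -/
theorem weight_nonneg : 0 ≤ S.η ^ S.d / S.η ^ 2 :=
  div_nonneg (pow_nonneg S.η_pos.le _) (pow_nonneg S.η_pos.le _)

/-- **`⟨λ, Δλ⟩ ≥ Σ_b η^{d−2}·(internal energy of b)`**: the bonds of `T_η` that are internal steps of some block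
form an injectively listed sub-family; all other bonds (between blocks, inside `Λ₀`, across levels) are dropped.
[cite: Balaban1984PropagatorsII, (2.11) p.225] -/
theorem sum_blocks_le_form [DecidableEq κ] (lam : ι → ℝ) :
    S.η ^ S.d / S.η ^ 2 * ∑ b, S.blockEnergy lam b ≤ S.form lam := by
  classical
  rw [form, ← Finset.mul_sum]
  refine mul_le_mul_of_nonneg_left ?_ S.weight_nonneg
  set T : Finset (Σ b, Fin S.d × (Fin S.d → Fin (S.side b + 1))) := univ.sigma fun b => S.adm b with hT
  set F : (Σ b, Fin S.d × (Fin S.d → Fin (S.side b + 1))) → κ := fun t => S.bond t.1 t.2.1 t.2.2 with hF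
  have hinj : Set.InjOn F ↑T := S.bond_sigma_injOn
  have h1 : ∑ b, S.blockEnergy lam b = ∑ t ∈ T, (lam (S.tgt (F t)) - lam (S.src (F t))) ^ 2 := by
    rw [hT, Finset.sum_sigma]
    exact Finset.sum_congr rfl fun b _ => S.blockEnergy_eq_sum_adm lam b
  rw [h1, ← Finset.sum_image (f := fun k => (lam (S.tgt k) - lam (S.src k)) ^ 2) hinj]
  exact Finset.sum_le_sum_of_subset_of_nonneg (Finset.subset_univ _) fun k _ _ => sq_nonneg _

/-! ## §3. (2.11): the constant 8, the sharp blockwise constants, positivity of Δ on N(Q′) -/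

/-- blockwise Poincaré ⇒ (2.11)-type bound: if on every block `g_b·Σ_y|λ(chart y)|² ≤ internal energy`, then
`η^{d−2}Σ_b g_b Σ_y |λ|² ≤ ⟨λ, Δλ⟩`. [cite: Balaban1984PropagatorsII, (2.11) p.225] -/
theorem form_ge_of_blockwise [DecidableEq κ] (lam : ι → ℝ) (g : β → ℝ)
    (hg : ∀ b, g b * ∑ y, lam (S.chart b y) ^ 2 ≤ S.blockEnergy lam b) :
    S.η ^ S.d / S.η ^ 2 * ∑ b, g b * ∑ y, lam (S.chart b y) ^ 2 ≤ S.form lam := by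
  refine le_trans ?_ (S.sum_blocks_le_form lam)
  exact mul_le_mul_of_nonneg_left (Finset.sum_le_sum fun b _ => hg b) S.weight_nonneg

omit [Fintype κ] [Fintype β] in
/-- rewriting one block term: `c·(blockMass)/((n+1)η)² = η^d/η²·(c/(n+1)²)·Σ_y|λ|²` (API for (2.11)).
[cite: Balaban1984PropagatorsII, (2.11) p.225] -/
theorem blockMass_div (lam : ι → ℝ) (b : β) (c : ℝ) :
    c * (S.blockMass lam b / (((S.side b : ℝ) + 1) * S.η) ^ 2) =
      S.η ^ S.d / S.η ^ 2 * (c / ((S.side b : ℝ) + 1) ^ 2 * ∑ y, lam (S.chart b y) ^ 2) := by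
  rw [blockMass, ← Finset.mul_sum]
  have hη : S.η ≠ 0 := S.η_pos.ne'
  have hn : ((S.side b : ℝ) + 1) ≠ 0 := by positivity
  field_simp

/-- **(2.11) WITH THE CONSTANT 8: `⟨λ, Δλ⟩ ≥ 8·Σ_{j=1}^k (L^jη)^{−2} Σ_{x∈B^j(Λ_j)} η^d|λ(x)|²` for every
`λ ∈ N(Q′)`** — on every block system; per block this is the mean-zero Poincaré inequality of [3] (2.27) with its
lattice constant 8 (`B4Block227.sum_sq_le_of_sum_eq_zero_coordCube8`), which is what *"as it follows from [3, 2.26,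
and 2.27]"* yields. [cite: Balaban1984PropagatorsII, (2.11) p.225] -/
theorem ineq211_eight [DecidableEq κ] : S.Ineq211 8 := by
  intro lam hlam
  rw [Finset.mul_sum]
  simp_rw [S.blockMass_div lam]
  rw [← Finset.mul_sum]
  refine S.form_ge_of_blockwise lam (fun b => 8 / ((S.side b : ℝ) + 1) ^ 2) fun b => ?_
  have h := B4Block227.sum_sq_le_of_sum_eq_zero_coordCube8 (S.side b) S.d (fun y => lam (S.chart b y)) (hlam.2 b)
  have hn : (0 : ℝ) < ((S.side b : ℝ) + 1) ^ 2 := by positivity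
  rw [div_mul_eq_mul_div, div_le_iff₀ hn]
  calc 8 * ∑ y, lam (S.chart b y) ^ 2
      ≤ 8 * (((S.side b : ℝ) + 1) ^ 2 / 8 * S.blockEnergy lam b) := by
        refine mul_le_mul_of_nonneg_left ?_ (by norm_num)
        simpa [blockEnergy] using h
    _ = S.blockEnergy lam b * ((S.side b : ℝ) + 1) ^ 2 := by ring

/-- the sharp Neumann gap of a block of side `s = n + 1`: `γ_s = 4s²sin²(π/(2s))` (`∈ [8, π²[` for `s ≥ 2`,
`B4Block227Sharp.eight_le_gap` / `gap_lt_pi_sq`). [cite: Balaban1983RegularityDecay, (2.27) p.580] -/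
noncomputable def gap (n : ℕ) : ℝ := 4 * ((n : ℝ) + 1) ^ 2 * sin (π / (2 * ((n : ℝ) + 1))) ^ 2

/-- **(2.11), SHARP BLOCKWISE FORM: `⟨λ, Δλ⟩ ≥ Σ_b γ_{L^j}·(L^jη)^{−2} Σ_{x∈b} η^d|λ(x)|²`**, `γ_s = 4s²sin²(π/(2s))`
the exact Neumann gap of the block (`B4Block227Sharp.poincare_coordCube_sharp`).
[cite: Balaban1984PropagatorsII, (2.11) p.225] -/
theorem ineq211_sharp [DecidableEq κ] (lam : ι → ℝ) (hlam : S.InGaugeSpace lam) :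
    ∑ b, gap (S.side b) * (S.blockMass lam b / (((S.side b : ℝ) + 1) * S.η) ^ 2) ≤ S.form lam := by
  simp_rw [S.blockMass_div lam]
  rw [← Finset.mul_sum]
  refine S.form_ge_of_blockwise lam (fun b => gap (S.side b) / ((S.side b : ℝ) + 1) ^ 2) fun b => ?_
  have hmean : Beta.BlockPoincare.avg univ (fun y => lam (S.chart b y)) = 0 := by
    unfold Beta.BlockPoincare.avg
    rw [hlam.2 b, zero_div]
  have h := B4Block227Sharp.poincare_coordCube_sharp (S.side b) S.d (fun y => lam (S.chart b y))
  simp only [hmean, sub_zero] at h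
  have hpos : 0 < 2 - 2 * cos (π / ((S.side b : ℝ) + 1)) := B4Block227Sharp.two_sub_two_cos_pos _
  have hgap : gap (S.side b) / ((S.side b : ℝ) + 1) ^ 2 = 2 - 2 * cos (π / ((S.side b : ℝ) + 1)) := by
    rw [gap, ← B4Block227Sharp.gap_eq, mul_comm, mul_div_assoc, div_self (by positivity), mul_one]
  rw [hgap]
  calc (2 - 2 * cos (π / ((S.side b : ℝ) + 1))) * ∑ y, lam (S.chart b y) ^ 2
      ≤ (2 - 2 * cos (π / ((S.side b : ℝ) + 1))) *
          (1 / (2 - 2 * cos (π / ((S.side b : ℝ) + 1))) * S.blockEnergy lam b) := by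
        refine mul_le_mul_of_nonneg_left ?_ hpos.le
        simpa [blockEnergy] using h
    _ = S.blockEnergy lam b := by rw [← mul_assoc, mul_one_div_cancel hpos.ne', one_mul]

/-- the blockwise sharp constants dominate 8 (blocks with ≥ 2 sites per direction) — so `ineq211_sharp` refines
`ineq211_eight`. [cite: Balaban1983RegularityDecay, (2.27) p.580] -/
theorem eight_le_gap {n : ℕ} (hn : 1 ≤ n) : 8 ≤ gap n := B4Block227Sharp.eight_le_gap hn

/-- … and stay strictly below the printed π². [cite: Balaban1983RegularityDecay, (2.27) p.580] -/
theorem gap_lt_pi_sq (n : ℕ) : gap n < π ^ 2 := B4Block227Sharp.gap_lt_pi_sq n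

/-- monotonicity of (2.11) in the constant. [cite: Balaban1984PropagatorsII, (2.11) p.225] -/
theorem ineq211_mono {c c' : ℝ} (hc : c' ≤ c) (h : S.Ineq211 c) : S.Ineq211 c' := by
  intro lam hlam
  refine le_trans ?_ (h lam hlam)
  refine mul_le_mul_of_nonneg_right hc (Finset.sum_nonneg fun b _ => ?_)
  refine div_nonneg (Finset.sum_nonneg fun y _ => ?_) (sq_nonneg _)
  exact mul_nonneg (pow_nonneg S.η_pos.le _) (sq_nonneg _)

/-- (2.11) holds with every constant `c ≤ 8`. [cite: Balaban1984PropagatorsII, (2.11) p.225] -/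
theorem ineq211_of_le_eight [DecidableEq κ] {c : ℝ} (hc : c ≤ 8) : S.Ineq211 c :=
  S.ineq211_mono hc S.ineq211_eight

/-- **"the Laplace operator Δ is positive on the subspace N(Q′), hence it is invertible on this subspace"** (p. 225):
under the cover (2.4) `T = Λ₀ ∪ ⋃_{j≥1} B^j(Λ_j)`, a gauge function `λ ∈ N(Q′)` with `⟨λ, Δλ⟩ = 0` vanishes
identically (the hypothesis `hinj` of `B6SectA.orbitMinimiser_unique`). [cite: Balaban1984PropagatorsII, (2.4) p.224, (2.11) p.225] -/
theorem eq_zero_of_form_eq_zero [DecidableEq κ] (hcover : ∀ x, x ∈ S.zeroSet ∨ ∃ b y, S.chart b y = x)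
    (lam : ι → ℝ) (hlam : S.InGaugeSpace lam) (h0 : S.form lam = 0) : lam = 0 := by
  have h8 := S.ineq211_eight lam hlam
  rw [h0] at h8
  have hterm : ∀ b, 0 ≤ S.blockMass lam b / (((S.side b : ℝ) + 1) * S.η) ^ 2 := fun b =>
    div_nonneg (Finset.sum_nonneg fun y _ => mul_nonneg (pow_nonneg S.η_pos.le _) (sq_nonneg _)) (sq_nonneg _)
  have hsum0 : ∑ b, S.blockMass lam b / (((S.side b : ℝ) + 1) * S.η) ^ 2 = 0 := by
    have hnn := Finset.sum_nonneg fun b (_ : b ∈ (univ : Finset β)) => hterm b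
    nlinarith
  have hb0 : ∀ b, S.blockMass lam b / (((S.side b : ℝ) + 1) * S.η) ^ 2 = 0 := fun b =>
    (Finset.sum_eq_zero_iff_of_nonneg fun b _ => hterm b).1 hsum0 b (mem_univ b)
  funext x
  rcases hcover x with hx | ⟨b, y, rfl⟩
  · exact hlam.1 x hx
  · have h1 := hb0 b
    have hden : (0 : ℝ) < (((S.side b : ℝ) + 1) * S.η) ^ 2 := by
      have := S.η_pos; positivity
    rw [div_eq_zero_iff] at h1
    rcases h1 with h1 | h1
    · rw [blockMass] at h1
      have hy := (Finset.sum_eq_zero_iff_of_nonneg fun y _ =>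
        mul_nonneg (pow_nonneg S.η_pos.le _) (sq_nonneg _)).1 h1 y (mem_univ y)
      have hηd : (0 : ℝ) < S.η ^ S.d := pow_pos S.η_pos _
      have : lam (S.chart b y) ^ 2 = 0 := by
        rcases mul_eq_zero.1 hy with h | h
        · exact absurd h hηd.ne'
        · exact h
      simpa using this
    · exact absurd h1 hden.ne'

end BlockSystem

/-! ## §4. The printed π² refuted: the 4 × 2 torus with two blocks of side 2 -/

section FourByTwo

/-- sites of the 4 × 2 torus (d = 2, η = 1). [cite: Balaban1984PropagatorsII, (2.11) p.225] -/
abbrev Site42 : Type := Fin 4 × Fin 2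

/-- bonds of the 4 × 2 torus: (site, direction). [cite: Balaban1984PropagatorsII, (2.11) p.225] -/
abbrev Bond42 : Type := Site42 × Fin 2

/-- `b₊`: one step in direction `μ` (periodic). [cite: Balaban1984PropagatorsII, (2.11) p.225] -/
def tgt42 (k : Bond42) : Site42 := if k.2 = 0 then (k.1.1 + 1, k.1.2) else (k.1.1, k.1.2 + 1)

/-- the first coordinate of the chart of block `b ∈ {0, 1}`: `2b + r`. [cite: Balaban1984PropagatorsII, (2.3) p.224] -/
def row42 (b r : Fin 2) : Fin 4 := ⟨2 * b.val + r.val, by omega⟩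

/-- the chart of block `b`: `y ↦ (2b + y₀, y₁)` (two 2 × 2 blocks side by side in direction 0).
[cite: Balaban1984PropagatorsII, (2.3) p.224] -/
def chart42 (b : Fin 2) (y : Fin 2 → Fin 2) : Site42 := (row42 b (y 0), y 1)

/-- **The block system `fourByTwo`**: T = the 4 × 2 torus with unit spacing, `k = 1`, `Λ₀ = ∅`, `Λ₁` = two blocks of
side `L = 2`. [cite: Balaban1984PropagatorsII, (2.1)–(2.4) p.224] -/
def fourByTwo : BlockSystem Site42 Bond42 (Fin 2) where
  d := 2
  η := 1
  src := fun k => k.1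
  tgt := tgt42
  zeroSet := ∅
  side := fun _ => 1
  chart := chart42
  bond := fun b μ y => (chart42 b y, μ)
  η_pos := one_pos
  chart_injective := by
    intro b
    change ∀ y y' : Fin 2 → Fin 2, chart42 b y = chart42 b y' → y = y'
    revert b
    decide
  chart_disjoint := by decide
  src_bond := fun _ _ _ _ => rfl
  tgt_bond := by decide

/-- the test gauge function `λ(x) = (1, −1, −1, 1)(x₀)`: mean zero on both blocks, the sign-alternated lowest Neumann
mode. [cite: Balaban1984PropagatorsII, (2.7) p.224] -/
def testLam (x : Site42) : ℝ := if x.1.val = 0 ∨ x.1.val = 3 then 1 else -1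

/-- enumerating the four points of the coordinate square `{0,1}²`. [folklore] -/
private theorem sum_sq2 (F : (Fin 2 → Fin 2) → ℝ) : ∑ y, F y = ∑ a : Fin 2, ∑ c : Fin 2, F ![a, c] := by
  rw [← Fintype.sum_prod_type']
  refine Fintype.sum_equiv (finTwoArrowEquiv (Fin 2)) _ _ fun y => ?_
  congr 1
  ext i
  fin_cases i <;> rfl

/-- `testLam ∈ N(Q′)`. [cite: Balaban1984PropagatorsII, (2.7) p.224] -/
theorem testLam_mem : fourByTwo.InGaugeSpace testLam := by
  refine ⟨fun x hx => absurd hx (Set.notMem_empty x), fun b => ?_⟩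
  change ∑ y : Fin 2 → Fin 2, testLam (chart42 b y) = 0
  rw [sum_sq2]
  fin_cases b <;> simp [chart42, row42, testLam, Fin.sum_univ_two]

/-- `⟨λ, Δλ⟩ = 16` for the test function. [cite: Balaban1984PropagatorsII, (2.11) p.225] -/
theorem form_testLam : fourByTwo.form testLam = 16 := by
  simp [BlockSystem.form, fourByTwo, tgt42, testLam, Fintype.sum_prod_type, Fin.sum_univ_four,
    Fin.sum_univ_two]
  norm_num [Fin.ext_iff]

/-- each block carries mass `Σ_{x∈b} η²|λ(x)|² = 4`. [cite: Balaban1984PropagatorsII, (2.11) p.225] -/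
theorem blockMass_testLam (b : Fin 2) : fourByTwo.blockMass testLam b = 4 := by
  change ∑ y : Fin 2 → Fin 2, (1 : ℝ) ^ (2 : ℕ) * testLam (chart42 b y) ^ 2 = 4
  rw [sum_sq2]
  fin_cases b <;> simp [chart42, row42, testLam] <;> norm_num

/-- the (2.11) right-hand side of the test function without its constant: `Σ_b (2·1)^{−2}·Σ_{x∈b}|λ(x)|² = 2`.
[cite: Balaban1984PropagatorsII, (2.11) p.225] -/
theorem mass_testLam :
    ∑ b, fourByTwo.blockMass testLam b / (((fourByTwo.side b : ℝ) + 1) * fourByTwo.η) ^ 2 = 2 := by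
  simp only [blockMass_testLam]
  change ∑ b : Fin 2, (4 : ℝ) / ((((1 : ℕ) : ℝ) + 1) * 1) ^ 2 = 2
  norm_num [Fin.sum_univ_two]

/-- **On `fourByTwo`, (2.11) with constant `c` holds iff `c ≤ 8`** — 8 is attained by `testLam`.
[cite: Balaban1984PropagatorsII, (2.11) p.225] -/
theorem ineq211_fourByTwo_iff (c : ℝ) : fourByTwo.Ineq211 c ↔ c ≤ 8 := by
  constructor
  · intro h
    have := h testLam testLam_mem
    rw [mass_testLam, form_testLam] at this
    linarith
  · intro hc
    exact fourByTwo.ineq211_of_le_eight hc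

/-- **THE PRINTED CONSTANT OF (2.11) IS REFUTED**: with `π²` the inequality fails on the 4 × 2 torus with two blocks of
side 2 (`⟨λ, Δλ⟩ = 16 < 2π²` for `testLam ∈ N(Q′)`).  Located cause: the slip π² ↔ `4s²sin²(π/2s)` of [3] (2.27)
(census G-B4-03); the valid universal constant is 8 (`BlockSystem.ineq211_eight`).
[cite: Balaban1984PropagatorsII, (2.11) p.225] -/
theorem not_ineq211_pi_sq : ¬ fourByTwo.Ineq211 (π ^ 2) := by
  rw [ineq211_fourByTwo_iff, not_le]
  nlinarith [Real.pi_gt_three]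

end FourByTwo

end

end Literature.MathematicalPhysics.QuantumFieldTheory.Balaban1983to89.B6Eq211
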